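import Literature.NumberTheory.GaloisCohomology.ShaRestrictedLayerToSelmer
import HarnessLib

/-!
# Descent of cocycles to the layer group: a continuous cocycle on `V ⊇ N_S` vanishing on `N_S`, with values in an
# equivariant image `e(M′) ⊆ M`, is the comparison image of a class of `H¹(V̄, M′^{N_S})` (`V̄ = V/N_S ≤ G_S`)

Topic `Literature/NumberTheory/GaloisCohomology` (namespace `Literature.NumberTheory.GaloisCohomology.ShaLayer`, sequel of
`ShaRestrictedLayerToSelmer`).  THEOREMS ONLY (no definition, no named fact, no instance, no `sorry`).  The converse
direction of `toSubgroupH1`: given a continuous `1`-cocycle `c` of an open subgroup `V ≤ Γ_K` containing the ramification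
subgroup `N_S` with values in a discrete `Γ_K`-module `M`,

* §1 `forall_ramificationSubgroup_eq_zero_of_forall_inertia` — if `c` vanishes on every inertia group `I_𝔓`, `𝔓 ∣ v ∉ S`,
  it vanishes on `N_S` (its zero set in `N_S` is a closed subgroup containing the conjugation-stable generating set
  `inertiaOutside K S`; subgroup version of `RestrictedRamificationDegreeOne`);
* §2 `exists_cocycle_descend` — if `c` vanishes on `N_S`, `N_S` acts trivially on `M′` and the values of `c` lie in the image
  of an injective `Γ_K`-equivariant `e : M′ → M`, then `c = e ∘ z ∘ π` for a continuous cocycle `z` of the layer group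
  `V̄ = V.map π` with values in `M′^{N_S}` (`z(π v) = e⁻¹(c v)`, well defined by the cocycle identity, locally constant because
  `π|_V` is open);
* §3 `exists_toSubgroupH1_eq_resOfLe` — hence `res^V_H [c] = toSubgroupH1 [z]` for every `H ≤ V`.

Written for cell `bsd-print-cf2` (seat cf2c-w8 g8, plug (π3) of ROW 1: the everywhere-unramified classes over `K̃_∞` are
exhausted by the images `ι_{n,k}` of the layer groups).  HONEST FRAMING: Galois-cohomological bookkeeping only.

## References
* J. Neukirch, A. Schmidt, K. Wingberg, *Cohomology of Number Fields* (2008), (1.6.7), VIII §3. [NeukirchSchmidtWingberg2008]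
* J.-P. Serre, *Galois Cohomology* (1997), I §2.4–2.6. [SerreGaloisCohomology1997]
* J. S. Milne, *Arithmetic Duality Theorems* (2006), I §4 (p. 55), Lemma 4.8. [MilneADT2006]
-/

noncomputable section

open Function Field IsDedekindDomain CategoryTheory
open scoped NumberField Pointwise
open Literature.NumberTheory.GaloisRepresentations
open Literature.NumberTheory.GaloisRepresentations.DiscreteGaloisModule
open Literature.NumberTheory.EllipticCurves

namespace Literature.NumberTheory.GaloisCohomology.ShaLayer

variable {K : Type} [Field K] [NumberField K] (S : Set (HeightOneSpectrum (𝓞 K)))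
variable {M' : Type} [AddCommGroup M'] [TopologicalSpace M'] [DiscreteTopology M'] (ρ : DiscreteGaloisModule K M')
variable {M : Type} [AddCommGroup M] [DistribMulAction (absoluteGaloisGroup K) M] [TopologicalSpace M]
  [DiscreteTopology M] (e : M' →+ M) (he : ∀ (σ : absoluteGaloisGroup K) (m : M'), e (ρ σ m) = σ • e m)
variable {H V : Subgroup (absoluteGaloisGroup K)}

/-! ## §1 Vanishing on `N_S` from vanishing on the inertia groups outside `S` -/

omit [NumberField K] in
/-- **A continuous cocycle of `V ⊇ N_S` vanishing on every inertia group `I_𝔓` (`𝔓 ∣ v ∉ S`) vanishes on `N_S`** (`V` closed):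
its zero set in `N_S` is a closed subgroup of `Γ_K` (cocycle identity: `c(στ) = c σ + σ•c τ`) containing `inertiaOutside K S`,
which is conjugation-stable, hence containing its normal closure and the topological closure `N_S` of the latter.
[cite: NeukirchSchmidtWingberg2008, (1.6.7) and VIII §3] -/
theorem forall_ramificationSubgroup_eq_zero_of_forall_inertia (hVc : IsClosed (V : Set (absoluteGaloisGroup K)))
    (hVS : ramificationSubgroup K S ≤ V) (c : contOneCocycles (discreteTopRep (↥V) M))
    (hc : ∀ (v : HeightOneSpectrum (𝓞 K)) (hv : v ∉ S) (𝔓 : Ideal (absIntegers (𝓞 K) K)) (h𝔓 : 𝔓 ∈ v.primesAbove)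
      (σ : absoluteGaloisGroup K) (hσ : σ ∈ 𝔓.inertia (absoluteGaloisGroup K)),
      c.1 ⟨σ, hVS (inertia_le_ramificationSubgroup hv h𝔓 hσ)⟩ = 0) :
    ∀ (σ : absoluteGaloisGroup K) (hσ : σ ∈ ramificationSubgroup K S), c.1 ⟨σ, hVS hσ⟩ = 0 := by
  -- the zero set of `c` in `V`, as a subgroup of `Γ_K`
  have hmul : ∀ a b : V, c.1 a = 0 → c.1 b = 0 → c.1 (a * b) = 0 := fun a b ha hb => by
    rw [c.2 a b, ha, hb, map_zero, add_zero]
  have hone : c.1 1 = 0 := contOneCocycles.apply_one c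
  have hinv : ∀ a : V, c.1 a = 0 → c.1 a⁻¹ = 0 := fun a ha => by
    have h := c.2 a⁻¹ a
    rw [inv_mul_cancel, hone, ha, map_zero, add_zero] at h
    exact h.symm
  let Z : Subgroup (absoluteGaloisGroup K) :=
    { carrier := {σ | ∃ hσ : σ ∈ V, c.1 ⟨σ, hσ⟩ = 0}
      one_mem' := ⟨V.one_mem, hone⟩
      mul_mem' := fun {a b} ha hb => by
        obtain ⟨ha, ha0⟩ := ha
        obtain ⟨hb, hb0⟩ := hb
        exact ⟨V.mul_mem ha hb, hmul ⟨a, ha⟩ ⟨b, hb⟩ ha0 hb0⟩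
      inv_mem' := fun {a} ha => by
        obtain ⟨ha, ha0⟩ := ha
        exact ⟨V.inv_mem ha, hinv ⟨a, ha⟩ ha0⟩ }
  -- `Z` is closed: the image of the clopen zero set of `c` under the closed embedding `V ↪ Γ_K`
  have hZc : IsClosed (Z : Set (absoluteGaloisGroup K)) := by
    have hZ : (Z : Set (absoluteGaloisGroup K)) = Subtype.val '' (c.1 ⁻¹' {0}) := by
      ext σ
      constructor
      · rintro ⟨hσ, h0⟩
        exact ⟨⟨σ, hσ⟩, h0, rfl⟩
      · rintro ⟨τ, h0, rfl⟩
        exact ⟨τ.2, h0⟩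
    rw [hZ]
    exact hVc.isClosedMap_subtype_val _ ((isClosed_discrete ({0} : Set M)).preimage c.1.continuous)
  -- `Z ⊇ inertiaOutside`, hence `Z ⊇` its normal closure (conjugation-stable generating set) and `N_S`
  have hgen : inertiaOutside K S ⊆ (Z : Set (absoluteGaloisGroup K)) := fun σ hσ => by
    obtain ⟨v, hv, 𝔓, h𝔓, hσ𝔓⟩ := mem_inertiaOutside_iff.mp hσ
    exact ⟨hVS (inertia_le_ramificationSubgroup hv h𝔓 hσ𝔓), hc v hv 𝔓 h𝔓 σ hσ𝔓⟩
  have hnc : Subgroup.normalClosure (inertiaOutside K S) ≤ Z := by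
    refine (Subgroup.closure_le Z).mpr fun x hx => ?_
    obtain ⟨a, ha, hax⟩ := Group.mem_conjugatesOfSet_iff.mp hx
    obtain ⟨τ, rfl⟩ := isConj_iff.mp hax
    exact hgen (conj_mem_inertiaOutside ha τ)
  have hle : ramificationSubgroup K S ≤ Z := Subgroup.topologicalClosure_minimal _ hnc hZc
  intro σ hσ
  obtain ⟨hσV, h0⟩ := hle hσ
  exact h0

/-! ## §2 Descent of a cocycle vanishing on `N_S` to the layer group -/

omit [NumberField K] in
/-- Independence of the lift: a cocycle of `V` vanishing on `N_S` is constant on the fibres of `π : V → V̄`.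
[cite: SerreGaloisCohomology1997, I §2.6] -/
theorem apply_eq_of_toUnramifiedQuot_eq (hVS : ramificationSubgroup K S ≤ V) (c : contOneCocycles (discreteTopRep (↥V) M))
    (hcN : ∀ (σ : absoluteGaloisGroup K) (hσ : σ ∈ ramificationSubgroup K S), c.1 ⟨σ, hVS hσ⟩ = 0)
    (v v' : V) (h : toUnramifiedQuot K S (v : absoluteGaloisGroup K) = toUnramifiedQuot K S (v' : absoluteGaloisGroup K)) :
    c.1 v = c.1 v' := by
  obtain ⟨n, hn, hvn⟩ := (QuotientGroup.mk'_eq_mk' _).mp h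
  have hv' : v' = v * ⟨n, hVS hn⟩ := Subtype.ext hvn.symm
  rw [hv', c.2 v ⟨n, hVS hn⟩, hcN n hn, map_zero, add_zero]

omit [NumberField K] in
include he in
/-- **DESCENT**: for `V` open with `N_S ≤ V`, `N_S` acting trivially on `M′`, `e : M′ → M` injective and `Γ_K`-equivariant, a
continuous cocycle `c` of `V` with values in `M` which vanishes on `N_S` and takes values in `e(M′)` is `e ∘ z ∘ π` for a
continuous cocycle `z` of the layer group `V̄ = V.map π ≤ G_S` with values in `M′^{N_S}`.
[cite: SerreGaloisCohomology1997, I §2.6] [cite: NeukirchSchmidtWingberg2008, (1.6.7)] -/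
theorem exists_cocycle_descend (hV : IsOpen (V : Set (absoluteGaloisGroup K))) (hVS : ramificationSubgroup K S ≤ V)
    (hρ : ramificationSubgroup K S ≤ ContinuousRep.ker ρ) (hinj : Function.Injective e)
    (c : contOneCocycles (discreteTopRep (↥V) M))
    (hcN : ∀ (σ : absoluteGaloisGroup K) (hσ : σ ∈ ramificationSubgroup K S), c.1 ⟨σ, hVS hσ⟩ = 0)
    (hce : ∀ v : V, c.1 v ∈ Set.range e) :
    ∃ z : contOneCocycles (subgroupRep (ρ.quotientInvariants (ramificationSubgroup K S)).toTopRep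
        (V.map (toUnramifiedQuot K S))),
      ∀ v : V, e ((z.1 ⟨toUnramifiedQuot K S v, Subgroup.mem_map_of_mem _ v.2⟩ :
        Representation.invariants (ρ.toRepresentation.comp (ramificationSubgroup K S).subtype)) : M') = c.1 v := by
  -- preimages of the values and lifts of the layer elements
  choose pre hpre using hce
  have hlift : ∀ y : V.map (toUnramifiedQuot K S), ∃ v : V, toUnramifiedQuot K S (v : absoluteGaloisGroup K) = y :=
    fun y => by
      obtain ⟨σ, hσ, hy⟩ := Subgroup.mem_map.mp y.2
      exact ⟨⟨σ, hσ⟩, hy⟩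
  choose lift hlift' using hlift
  -- every element of `M′` is `N_S`-invariant
  have hmem : ∀ m : M', m ∈ Representation.invariants (ρ.toRepresentation.comp (ramificationSubgroup K S).subtype) :=
    fun m => (Representation.mem_invariants _ _).mpr fun n => by
      have h := (ContinuousRep.mem_ker _ _).mp (hρ n.2)
      change ρ (n : absoluteGaloisGroup K) m = m
      rw [h]
      rfl
  -- `pre` is constant on the fibres of `π`
  have hpre_eq : ∀ v v' : V, toUnramifiedQuot K S (v : absoluteGaloisGroup K) = toUnramifiedQuot K S (v' : absoluteGaloisGroup K) →
      pre v = pre v' := fun v v' h =>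
    hinj (by rw [hpre, hpre, apply_eq_of_toUnramifiedQuot_eq S hVS c hcN v v' h])
  -- the descended function and its local constancy
  let z₀ : V.map (toUnramifiedQuot K S) → Representation.invariants (ρ.toRepresentation.comp (ramificationSubgroup K S).subtype) :=
    fun y => ⟨pre (lift y), hmem _⟩
  have hz₀ : ∀ v : V, z₀ ⟨toUnramifiedQuot K S v, Subgroup.mem_map_of_mem _ v.2⟩ = ⟨pre v, hmem _⟩ := fun v =>
    Subtype.ext (hpre_eq _ _ (hlift' _))
  have hlc : IsLocallyConstant z₀ := by
    refine (IsLocallyConstant.iff_exists_open _).mpr fun y₀ => ?_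
    set O : Set V := {v : V | c.1 v = c.1 (lift y₀)} with hO
    have hOo : IsOpen O := (isOpen_discrete ({c.1 (lift y₀)} : Set M)).preimage c.1.continuous
    refine ⟨Subtype.val ⁻¹' (toUnramifiedQuot K S '' (Subtype.val '' O)),
      ((isOpenMap_toUnramifiedQuot K S _ (hV.isOpenMap_subtype_val _ hOo)).preimage continuous_subtype_val),
      ⟨(lift y₀ : absoluteGaloisGroup K), ⟨lift y₀, rfl, rfl⟩, hlift' y₀⟩, fun y hy => ?_⟩
    obtain ⟨σ, ⟨v, hv, rfl⟩, hyv⟩ := hy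
    change (⟨pre (lift y), hmem _⟩ : Representation.invariants _) = ⟨pre (lift y₀), hmem _⟩
    apply Subtype.ext
    change pre (lift y) = pre (lift y₀)
    refine hinj ?_
    rw [hpre, hpre, apply_eq_of_toUnramifiedQuot_eq S hVS c hcN (lift y) v ((hlift' y).trans hyv.symm)]
    exact hv
  -- the cocycle identity
  refine ⟨⟨⟨z₀, hlc.continuous⟩, fun y y' => ?_⟩, fun v => ?_⟩
  · apply Subtype.ext
    refine hinj ?_
    change e (pre (lift (y * y'))) = e ((pre (lift y) : M') +
      ((ρ.quotientInvariants (ramificationSubgroup K S) ((y : V.map (toUnramifiedQuot K S)) :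
        GaloisGroupUnramifiedOutside K S) ⟨pre (lift y'), hmem _⟩ : Representation.invariants _) : M'))
    have hyy' : toUnramifiedQuot K S ((lift y * lift y' : V) : absoluteGaloisGroup K) =
        ((y * y' : V.map (toUnramifiedQuot K S)) : GaloisGroupUnramifiedOutside K S) := by
      rw [Subgroup.coe_mul, map_mul, hlift', hlift', Subgroup.coe_mul]
    rw [hpre_eq (lift (y * y')) (lift y * lift y') ((hlift' _).trans hyy'.symm), map_add, hpre, hpre, c.2]
    congr 1
    -- `(lift y) • e (pre (lift y')) = e (ρ (lift y) (pre (lift y')))`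
    have hy : ((y : V.map (toUnramifiedQuot K S)) : GaloisGroupUnramifiedOutside K S) =
        toUnramifiedQuot K S (lift y : absoluteGaloisGroup K) := (hlift' y).symm
    rw [hy]
    change ((lift y : V) : absoluteGaloisGroup K) • c.1 (lift y') = e (ρ (lift y : absoluteGaloisGroup K) (pre (lift y')))
    rw [he, hpre]
  · change e ((z₀ ⟨toUnramifiedQuot K S v, Subgroup.mem_map_of_mem _ v.2⟩ :
      Representation.invariants (ρ.toRepresentation.comp (ramificationSubgroup K S).subtype)) : M') = c.1 v
    rw [hz₀, hpre]

/-! ## §3 The class-level statement -/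

omit [NumberField K] in
/-- **`res^V_H [c] = toSubgroupH1 [z]`**: under the hypotheses of `exists_cocycle_descend`, for every `H ≤ V` the restriction
to `H` of the class of `c` is the comparison image (`toSubgroupH1`: restriction along `H → V̄` and coefficients `e`) of a class
of the layer group `H¹(V̄, M′^{N_S})`. [cite: SerreGaloisCohomology1997, I §2.4–2.6] [cite: MilneADT2006, I §4 Lemma 4.8] -/
theorem exists_toSubgroupH1_eq_resOfLe (hV : IsOpen (V : Set (absoluteGaloisGroup K)))
    (hVS : ramificationSubgroup K S ≤ V) (hρ : ramificationSubgroup K S ≤ ContinuousRep.ker ρ)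
    (hinj : Function.Injective e) (hHV : H ≤ V) (c : contOneCocycles (discreteTopRep (↥V) M))
    (hcN : ∀ (σ : absoluteGaloisGroup K) (hσ : σ ∈ ramificationSubgroup K S), c.1 ⟨σ, hVS hσ⟩ = 0)
    (hce : ∀ v : V, c.1 v ∈ Set.range e) :
    ∃ z : continuousCohomology 1 (subgroupRep (ρ.quotientInvariants (ramificationSubgroup K S)).toTopRep
        (V.map (toUnramifiedQuot K S))),
      toSubgroupH1 S ρ e he hHV z = resOfLe M hHV (oneCocycleClass _ c) := by
  obtain ⟨z, hz⟩ := exists_cocycle_descend S ρ e he hV hVS hρ hinj c hcN hce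
  refine ⟨oneCocycleClass _ z, ?_⟩
  rw [toSubgroupH1_oneCocycleClass]
  have hres : resOfLe M hHV (oneCocycleClass _ c) =
      oneCocycleClass _ (contOneCocycles.pullback (subgroupInclusion hHV)
        (resHomOfEquivariant (subgroupInclusion hHV) (AddMonoidHom.id M) (fun _ _ ↦ rfl)) c) :=
    map_oneCocycleClass _ _ _ c
  rw [hres]
  refine congrArg (oneCocycleClass _) (Subtype.ext (ContinuousMap.ext fun h => ?_))
  rw [pullback_toLayerGroup_apply]
  exact hz (Subgroup.inclusion hHV h)

end Literature.NumberTheory.GaloisCohomology.ShaLayer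

end
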